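import Summits.FinalStateConjecture.FinalStateConjecture.Theorems.EIHFluxBalanceInertialRecessionStubIdentificationCovariance
import Summits.FinalStateConjecture.FinalStateConjecture.Theorems.EIHFluxBalanceEIHFluxEvaluationKSBoost
import Summits.FinalStateConjecture.FinalStateConjecture.Theorems.EIHFluxBalanceEIHFluxEvaluationKSCharge
import Literature.Geometry.Lorentzian.KerrSchildCoord

/-!
# Route EIHFluxBalance — `InertialRecession`, line `sublinear-is-free-clean-window-charges`:
# the Landau–Lifshitz four-momentum of a BOOSTED Schwarzschild hole is `M γ (1, v)` on every lab
# sphere enclosing it (stub `stub_identification`, part A1d)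

Helper file (`--supports stmt-FinalStateConjecture-10166`) for the crux
`Summit.FinalStateConjecture.FinalStateConjecture.Theses.EIHFluxBalance.InertialRecession`.

The exact ("`+ 0`") boosted form of clause (a) of the identification: for the stationary boosted,
translated Schwarzschild components `boostedKerrBilin Λ c M 0` (`Λ ∈ O(1,3)` arbitrary, `u = Λe₀`,
lab velocity `v = u~/u⁰`, Lorentz factor `γ = |u⁰| = (1 − |v|²)^{-1/2}`) and every lab coordinate
sphere `{x⁰ = t, |y − ξ| = R}` enclosing the lab position of the hole at lab time `t`,
`P^0(t; ξ, R) = M γ` and `P^k(t; ξ, R) = M γ v^k`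
(`quasiLocalMomentum_boostedSchwarzschild_energy/_momentum`). Assembly of
`quasiLocalMomentum_linChart_static` (covariance under `x ↦ Λ⁻¹x`, file `…Covariance`) with the
tree's rest-frame value `P^μ[g_{M,0}](0; 0, ρ) = M δ^μ_0` (`KSFlux.quasiLocalMomentum_schwarzschild_centre`),
the vacuum/Kerr–Schild exactness of the boosted components (`KSFlux.emComplex_boostedKerr_eq_zero`,
`KSFlux.emComplex_kerr_eq_zero`), `(det Λ)² = 1` and the cofactor identity `|det A| = |u⁰|` for the
spatial block `A` of `Λ⁻¹`. Landau–Lifshitz §96: "the four-momentum of the field plus matter is a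
four-vector". [cite: LandauLifshitz1975, §96 (96.16)–(96.17)]
-/

set_option linter.dupNamespace false

noncomputable section

-- instance search on the nested operator spaces `E4 →L[ℝ] E4 →L[ℝ] ℝ` is deep
set_option maxSynthPendingDepth 3

open Set Metric Filter MeasureTheory MeasureTheory.Measure Module
open scoped Topology ContDiff RealInnerProductSpace Matrix

namespace Summit.FinalStateConjecture.FinalStateConjecture.Theorems

namespace SublinearIsFree.ChargeModel

open Literature.Geometry.Lorentzian Literature.Geometry.Lorentzian.LandauLifshitz
open Literature.Analysis.FluidPDE LLBalance LLGauss SublinearIsFree.WindowCharges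

/-! ### Lorentz matrices: `(det Λ)² = 1` and the cofactor of the time–time entry -/

/-- **`(det Λ)² = 1` for a Lorentz matrix**, through the coordinate matrix of `Λ⁻¹` as a change of
chart for the constant components `η`: `det η = (det P)² det η`. [cite: ONeill1983, Ch. 9 p. 233] -/
theorem det_sq_lorentz_symm (Λ : lorentzGroup) :
    (Matrix.of fun i j : Fin 4 ↦ ((((Λ : E4 ≃L[ℝ] E4).symm : E4 ≃L[ℝ] E4) : E4 →L[ℝ] E4)
      (E4.basisVector j)) i).det ^ 2 = 1 := by
  have hg' : ∀ x v w : E4, (fun _ : E4 ↦ Minkowski.bilin) x v w =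
      (fun _ : E4 ↦ Minkowski.bilin) ((((Λ : E4 ≃L[ℝ] E4).symm : E4 ≃L[ℝ] E4) : E4 →L[ℝ] E4) x)
        ((((Λ : E4 ≃L[ℝ] E4).symm : E4 ≃L[ℝ] E4) : E4 →L[ℝ] E4) v)
        ((((Λ : E4 ≃L[ℝ] E4).symm : E4 ≃L[ℝ] E4) : E4 →L[ℝ] E4) w) :=
    fun x v w ↦ (lorentzGroup.minkowski_symm_apply Λ v w).symm
  have h := metricDet_linChart (g := fun _ : E4 ↦ Minkowski.bilin) (g' := fun _ : E4 ↦ Minkowski.bilin)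
    ((((Λ : E4 ≃L[ℝ] E4).symm : E4 ≃L[ℝ] E4) : E4 →L[ℝ] E4)) hg' 0
  rw [metricDet_minkowski, metricDet_minkowski] at h
  linarith

/-- **The time–time cofactor**: for an invertible `4 × 4` matrix `P`,
`(P⁻¹)₀₀ det P = det (P_{m+1,j+1})` (Cramer's rule and the Laplace expansion along the first row).
[folklore] -/
theorem inv_zero_zero_mul_det (P : Matrix (Fin 4) (Fin 4) ℝ) (hP : P.det ≠ 0) :
    P⁻¹ 0 0 * P.det = (P.submatrix Fin.succ Fin.succ).det := by
  have hadj : (P.updateRow 0 (Pi.single (0 : Fin 4) (1 : ℝ))).det =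
      (P.submatrix Fin.succ Fin.succ).det := by
    have hsub : (P.updateRow 0 (Pi.single (0 : Fin 4) (1 : ℝ))).submatrix Fin.succ
        (Fin.succAbove 0) = P.submatrix Fin.succ Fin.succ := by
      ext m k
      simp [Matrix.submatrix_apply]
    have hrest : ∀ j : Fin 3, (P.updateRow 0 (Pi.single (0 : Fin 4) (1 : ℝ))) 0 j.succ = 0 :=
      fun j ↦ by rw [Matrix.updateRow_self, Pi.single_apply, if_neg (Fin.succ_ne_zero j)]
    have hfirst : (P.updateRow 0 (Pi.single (0 : Fin 4) (1 : ℝ))) 0 0 = 1 := by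
      rw [Matrix.updateRow_self, Pi.single_eq_same]
    rw [Matrix.det_succ_row_zero, Fin.sum_univ_succ]
    simp only [hsub, hrest, hfirst, mul_zero, zero_mul, Finset.sum_const_zero, add_zero,
      Fin.val_zero, pow_zero, one_mul]
  rw [Matrix.inv_def, Matrix.smul_apply, smul_eq_mul, Ring.inverse_eq_inv, Matrix.adjugate_apply, hadj]
  field_simp

/-! ### The hole's lab position and the spatial block of `Λ⁻¹` -/

/-- **Lab slices are transverse to the rest time axis**: `y ↦ (Λ⁻¹(0, y))~` is injective (a vector
`Λ⁻¹(0, y)` on the time axis would be `Λ⁻¹` of a multiple of `u = Λe₀`, whose time component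
`u⁰ ≠ 0` forces it to vanish). [cite: ONeill1983, Ch. 9 p. 233] -/
theorem injective_spatial_lorentz_symm_slice (Λ : lorentzGroup) :
    Function.Injective fun y : E3 ↦ E4.spatial ((Λ : E4 ≃L[ℝ] E4).symm (E4.ofTimeSpace 0 y)) := by
  obtain ⟨S, hS⟩ := exists_clm_ofTimeSpace_zero
  have h0 : ((Λ : E4 ≃L[ℝ] E4) (E4.basisVector 0)) 0 ≠ 0 := fun h ↦
    absurd (one_le_abs_lorentz_apply_zero Λ) (by rw [h, abs_zero]; norm_num)
  -- the kernel is trivial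
  have key : ∀ d : E3, E4.spatial ((Λ : E4 ≃L[ℝ] E4).symm (E4.ofTimeSpace 0 d)) = 0 → d = 0 := by
    intro d hd
    set z : E4 := (Λ : E4 ≃L[ℝ] E4).symm (E4.ofTimeSpace 0 d) with hz
    have hz' : z = (z 0) • E4.basisVector 0 := by
      have h := (E4.ofTimeSpace_time_spatial z).symm
      rw [hd, E4.time_apply, ofTimeSpace_eq_smul_add_ofTimeSpace_zero] at h
      rw [h]
      ext i
      refine Fin.cases ?_ (fun k ↦ ?_) i <;> simp
    have hΛz : (Λ : E4 ≃L[ℝ] E4) z = E4.ofTimeSpace 0 d := by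
      rw [hz, ContinuousLinearEquiv.apply_symm_apply]
    have hcomp : (0 : ℝ) = z 0 * ((Λ : E4 ≃L[ℝ] E4) (E4.basisVector 0)) 0 := by
      have h := congrArg (fun v : E4 ↦ v 0) hΛz
      simp only [E4.ofTimeSpace_apply_zero] at h
      rw [hz', map_smul, PiLp.smul_apply, smul_eq_mul] at h
      exact h.symm
    have hz0 : z 0 = 0 := by
      rcases mul_eq_zero.1 hcomp.symm with h | h
      · exact h
      · exact absurd h h0
    have hzero : z = 0 := by rw [hz', hz0, zero_smul]
    have h := hΛz
    rw [hzero, map_zero] at h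
    have h2 := congrArg E4.spatial h
    rw [map_zero, E4.spatial_ofTimeSpace] at h2
    exact h2.symm
  intro y y' h
  have hlin : E4.spatial ((Λ : E4 ≃L[ℝ] E4).symm (E4.ofTimeSpace 0 (y - y'))) = 0 := by
    rw [← hS, map_sub, map_sub, map_sub, hS, hS, sub_eq_zero]
    exact h
  exact sub_eq_zero.1 (key _ hlin)

/-! ### The four-momentum of a boosted Schwarzschild hole -/

/-- **The Landau–Lifshitz four-momentum of a boosted Schwarzschild hole** (raw form): for
`Λ ∈ O(1,3)`, `c ∈ E4`, `u = Λe₀`, and every lab sphere `{x⁰ = t, |y − ξ| = R}` enclosing the lab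
position of the hole at lab time `t` (the unique `y` with `(Λ⁻¹((t, y) − c))~ = 0`),
`P^μ[boostedKerrBilin Λ c M 0](t; ξ, R) = M |u⁰|⁻¹ u⁰ u^μ`. [cite: LandauLifshitz1975, §96 (96.16)–(96.17)] -/
theorem quasiLocalMomentum_boostedSchwarzschild (Λ : lorentzGroup) (c : E4) (M : ℝ) {t : ℝ} {ξ : E3}
    {R : ℝ} (hR : 0 < R)
    (hencl : ∀ y : E3, E4.spatial (poincareInv Λ c (E4.ofTimeSpace t y)) = 0 → y ∈ ball ξ R)
    (μ : Fin 4) :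
    quasiLocalMomentum (boostedKerrBilin Λ c M 0) t ξ R μ =
      M * |((Λ : E4 ≃L[ℝ] E4) (E4.basisVector 0)) 0|⁻¹ * ((Λ : E4 ≃L[ℝ] E4) (E4.basisVector 0)) 0 *
        ((Λ : E4 ≃L[ℝ] E4) (E4.basisVector 0)) μ := by
  -- Step T: remove the translation
  have htr : boostedKerrBilin Λ c M 0 = fun z ↦ boostedKerrBilin Λ 0 M 0 (z - c) := by
    funext z
    ext v w
    simp only [boostedKerrBilin_apply, poincareInv, sub_zero]
  rw [htr, KSCharge.quasiLocalMomentum_comp_sub]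
  -- Step C: the covariance theorem for `L = Λ⁻¹`, `K = {0}`, `ρ = 1`
  have hrad : ∀ x : E4, E4.spatial x ∉ ({0} : Set E3) → 0 < Kerr.radius 0 x := fun x hx ↦ by
    rw [Kerr.radius_zero_left]
    exact norm_pos_iff.2 hx
  have hreg : ∀ x : E4, E4.spatial x ∉ ({0} : Set E3) → x ∈ Kerr.region 0 0 := fun x hx ↦ by
    rw [Kerr.mem_region, max_self]
    exact hrad x hx
  have hpi : ∀ x : E4, poincareInv Λ 0 x = (Λ : E4 ≃L[ℝ] E4).symm x := fun x ↦ by rw [poincareInv, sub_zero]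
  have hg' : ∀ x v w : E4, boostedKerrBilin Λ 0 M 0 x v w =
      Kerr.bilin M 0 ((Λ : E4 ≃L[ℝ] E4).symm x) ((Λ : E4 ≃L[ℝ] E4).symm v) ((Λ : E4 ≃L[ℝ] E4).symm w) := fun x v w ↦ by
    rw [boostedKerrBilin_apply, hpi]
  have hg : ContDiffOn ℝ ∞ (Kerr.bilin M 0) {x : E4 | E4.spatial x ∉ ({0} : Set E3)} :=
    fun x hx ↦ (Kerr.contDiffAt_bilin M 0 (hrad x hx)).contDiffWithinAt
  have hdet : ∀ x : E4, E4.spatial x ∉ ({0} : Set E3) → metricDet (Kerr.bilin M 0) x ≠ 0 :=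
    fun x hx ↦ by
      rw [show metricDet (Kerr.bilin M 0) x = -1 from KSMatrix.metricDet_kerr M 0 (hrad x hx)]
      norm_num
  have hem : ∀ x : E4, E4.spatial x ∉ ({0} : Set E3) → ∀ μ ν, emComplex (Kerr.bilin M 0) x μ ν = 0 :=
    fun x hx μ ν ↦ KSFlux.emComplex_kerr_eq_zero M 0 0 (hreg x hx) μ ν
  have hg'c : ContDiffOn ℝ ∞ (boostedKerrBilin Λ 0 M 0)
      {x : E4 | E4.spatial ((Λ : E4 ≃L[ℝ] E4).symm x) ∉ ({0} : Set E3)} := fun x hx ↦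
    (contDiffAt_boostedKerrBilin Λ 0 M 0 (by rw [hpi]; exact hrad _ hx)).contDiffWithinAt
  have hem' : ∀ x : E4, E4.spatial ((Λ : E4 ≃L[ℝ] E4).symm x) ∉ ({0} : Set E3) → ∀ μ,
      emComplex (boostedKerrBilin Λ 0 M 0) x μ 0 = 0 := fun x hx μ ↦
    KSFlux.emComplex_boostedKerr_eq_zero Λ 0 M 0 0 (by
      show poincareInv Λ 0 x ∈ (Kerr.region 0 0 : Set E4)
      rw [hpi]
      exact hreg _ hx) μ 0
  have hKin : ∀ y : E3, E4.spatial ((Λ : E4 ≃L[ℝ] E4).symm (E4.ofTimeSpace (t - c 0) y)) ∈ ({0} : Set E3) →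
      y ∈ ball (ξ - E4.spatial c) R := by
    intro y hy
    have h := hencl (y + E4.spatial c) (by
      rw [poincareInv, KSCharge.ofTimeSpace_sub, add_sub_cancel_right]
      exact hy)
    rw [mem_ball, dist_eq_norm] at h ⊢
    rwa [show y - (ξ - E4.spatial c) = y + E4.spatial c - ξ by abel]
  have hcov := quasiLocalMomentum_linChart_static (g := Kerr.bilin M 0) (g' := boostedKerrBilin Λ 0 M 0)
    (Λ : E4 ≃L[ℝ] E4).symm hg' isCompact_singleton hg hdet hem (Kerr.bilin_add_smul_basisVector_zero M 0) hg'c hem'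
    (injective_spatial_lorentz_symm_slice Λ) hR hKin one_pos
    (by rw [Set.singleton_subset_iff, mem_ball, dist_self]; exact one_pos) μ
  rw [hcov]
  -- Step V: evaluate
  simp only [ContinuousLinearEquiv.symm_symm, KSFlux.quasiLocalMomentum_schwarzschild_centre M 0
    one_pos, mul_ite, mul_zero, Finset.sum_ite_eq', Finset.mem_univ, if_true]
  -- the spatial block: `|det A| = |u⁰|`
  set P : Matrix (Fin 4) (Fin 4) ℝ :=
    Matrix.of fun i j : Fin 4 ↦ (((Λ : E4 ≃L[ℝ] E4).symm : E4 →L[ℝ] E4) (E4.basisVector j)) i with hP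
  have hPdet : P.det ^ 2 = 1 := det_sq_lorentz_symm Λ
  have hPdet0 : P.det ≠ 0 := fun h ↦ by
    rw [h] at hPdet
    norm_num at hPdet
  have hQ : (Matrix.of fun i j : Fin 4 ↦ (((Λ : E4 ≃L[ℝ] E4) : E4 →L[ℝ] E4) (E4.basisVector j)) i) = P⁻¹ := by
    have h := linChartMatrix_symm_eq_inv (Λ : E4 ≃L[ℝ] E4).symm
    rw [ContinuousLinearEquiv.symm_symm] at h
    exact h
  have hA : (Matrix.of fun m j : Fin 3 ↦ ((Λ : E4 ≃L[ℝ] E4).symm (E4.basisVector j.succ)) m.succ) =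
      P.submatrix Fin.succ Fin.succ := by
    ext m j
    rfl
  have hu0 : ((Λ : E4 ≃L[ℝ] E4) (E4.basisVector 0)) 0 = P⁻¹ 0 0 := by
    rw [← hQ, Matrix.of_apply]
    rfl
  have habs : |(Matrix.of fun m j : Fin 3 ↦ ((Λ : E4 ≃L[ℝ] E4).symm (E4.basisVector j.succ)) m.succ).det| =
      |((Λ : E4 ≃L[ℝ] E4) (E4.basisVector 0)) 0| := by
    rw [hA, ← inv_zero_zero_mul_det P hPdet0, abs_mul, ← hu0]
    have h1 : |P.det| = 1 := by
      have h2 : |P.det| ^ 2 = 1 := by rw [sq_abs, hPdet]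
      nlinarith [abs_nonneg P.det]
    rw [h1, mul_one]
  rw [habs, hPdet]
  simp only [Matrix.of_apply, ContinuousLinearEquiv.coe_coe]
  ring

/-- `γ = |u⁰| = (1 − |v|²)^{-1/2}` for `v = u~/u⁰`, `u = Λe₀` (`η(u, u) = −1`).
[cite: ONeill1983, Ch. 9 p. 233] -/
theorem abs_lorentz_apply_zero_eq_gamma (Λ : lorentzGroup) :
    |((Λ : E4 ≃L[ℝ] E4) (E4.basisVector 0)) 0| =
      (√(1 -
        ‖(((Λ : E4 ≃L[ℝ] E4) (E4.basisVector 0)) 0)⁻¹ • E4.spatial ((Λ : E4 ≃L[ℝ] E4) (E4.basisVector 0))‖ ^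
          2))⁻¹ := by
  set u : E4 := (Λ : E4 ≃L[ℝ] E4) (E4.basisVector 0) with hu
  have h0 : u 0 ≠ 0 := fun h ↦
    absurd (one_le_abs_lorentz_apply_zero Λ) (by rw [← hu, h, abs_zero]; norm_num)
  have hsq : u 0 ^ 2 = 1 + ‖E4.spatial u‖ ^ 2 := lorentz_apply_zero_sq Λ
  have h1 : 1 - ‖(u 0)⁻¹ • E4.spatial u‖ ^ 2 = ((u 0) ^ 2)⁻¹ := by
    rw [norm_smul, mul_pow, norm_inv, Real.norm_eq_abs, inv_pow, sq_abs]
    field_simp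
    linarith
  rw [h1, Real.sqrt_inv, inv_inv, Real.sqrt_sq_eq_abs]

/-- **The quasi-local energy of a boosted Schwarzschild hole is `Mγ`** on every lab sphere enclosing
it: `P^0[boostedKerrBilin Λ c M 0](t; ξ, R) = M (1 − |v|²)^{-1/2}`, `v = (Λe₀)~/(Λe₀)⁰`.
[cite: LandauLifshitz1975, §96 (96.16)–(96.17)] -/
theorem quasiLocalMomentum_boostedSchwarzschild_energy (Λ : lorentzGroup) (c : E4) (M : ℝ) {t : ℝ}
    {ξ : E3} {R : ℝ} (hR : 0 < R)
    (hencl : ∀ y : E3, E4.spatial (poincareInv Λ c (E4.ofTimeSpace t y)) = 0 → y ∈ ball ξ R) :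
    quasiLocalMomentum (boostedKerrBilin Λ c M 0) t ξ R 0 =
      M * (√(1 - ‖(((Λ : E4 ≃L[ℝ] E4) (E4.basisVector 0)) 0)⁻¹ •
        E4.spatial ((Λ : E4 ≃L[ℝ] E4) (E4.basisVector 0))‖ ^ 2))⁻¹ := by
  rw [quasiLocalMomentum_boostedSchwarzschild Λ c M hR hencl 0, ← abs_lorentz_apply_zero_eq_gamma]
  set u0 : ℝ := ((Λ : E4 ≃L[ℝ] E4) (E4.basisVector 0)) 0 with hu0
  have ha : |u0| ≠ 0 := abs_ne_zero.2 fun h ↦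
    absurd (one_le_abs_lorentz_apply_zero Λ) (by rw [← hu0, h, abs_zero]; norm_num)
  calc M * |u0|⁻¹ * u0 * u0 = M * (|u0|⁻¹ * (|u0| * |u0|)) := by
        rw [abs_mul_abs_self]
        ring
    _ = M * |u0| := by rw [inv_mul_cancel_left₀ ha]

/-- **The quasi-local momentum of a boosted Schwarzschild hole is `Mγv`** on every lab sphere
enclosing it: `P^k[boostedKerrBilin Λ c M 0](t; ξ, R) = M (1 − |v|²)^{-1/2} v^k`,
`v = (Λe₀)~/(Λe₀)⁰`. [cite: LandauLifshitz1975, §96 (96.16)–(96.17)] -/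
theorem quasiLocalMomentum_boostedSchwarzschild_momentum (Λ : lorentzGroup) (c : E4) (M : ℝ)
    {t : ℝ} {ξ : E3} {R : ℝ} (hR : 0 < R)
    (hencl : ∀ y : E3, E4.spatial (poincareInv Λ c (E4.ofTimeSpace t y)) = 0 → y ∈ ball ξ R)
    (k : Fin 3) :
    quasiLocalMomentum (boostedKerrBilin Λ c M 0) t ξ R k.succ =
      M * (√(1 - ‖(((Λ : E4 ≃L[ℝ] E4) (E4.basisVector 0)) 0)⁻¹ •
        E4.spatial ((Λ : E4 ≃L[ℝ] E4) (E4.basisVector 0))‖ ^ 2))⁻¹ *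
        ((((Λ : E4 ≃L[ℝ] E4) (E4.basisVector 0)) 0)⁻¹ •
          E4.spatial ((Λ : E4 ≃L[ℝ] E4) (E4.basisVector 0))) k := by
  rw [quasiLocalMomentum_boostedSchwarzschild Λ c M hR hencl k.succ,
    ← abs_lorentz_apply_zero_eq_gamma, PiLp.smul_apply, smul_eq_mul, E4.spatial_apply]
  set u0 : ℝ := ((Λ : E4 ≃L[ℝ] E4) (E4.basisVector 0)) 0 with hu0
  have h0 : u0 ≠ 0 := fun h ↦
    absurd (one_le_abs_lorentz_apply_zero Λ) (by rw [← hu0, h, abs_zero]; norm_num)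
  have ha : |u0| ≠ 0 := abs_ne_zero.2 h0
  -- `|u⁰|⁻¹ u⁰ = |u⁰| (u⁰)⁻¹`, both being `u⁰ u⁰ / (|u⁰| u⁰)`
  have key : |u0|⁻¹ * u0 = |u0| * u0⁻¹ := by
    field_simp
    rw [sq_abs]
  calc M * |u0|⁻¹ * u0 * ((Λ : E4 ≃L[ℝ] E4) (E4.basisVector 0)) k.succ
      = M * (|u0|⁻¹ * u0) * ((Λ : E4 ≃L[ℝ] E4) (E4.basisVector 0)) k.succ := by ring
    _ = M * |u0| * (u0⁻¹ * ((Λ : E4 ≃L[ℝ] E4) (E4.basisVector 0)) k.succ) := by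
      rw [key]
      ring

end SublinearIsFree.ChargeModel

/-- Registered sub-goal form (stub `ll_boostedSchwarzschild_energy` of the crux item) of
`SublinearIsFree.ChargeModel.quasiLocalMomentum_boostedSchwarzschild_energy`: the LL energy of a
boosted Schwarzschild hole on every enclosing lab sphere is `Mγ`. [cite: LandauLifshitz1975, §96 (96.16)–(96.17)] -/
theorem ll_boostedSchwarzschild_energy : open Literature.Geometry.Lorentzian Metric in ∀ (Λ : lorentzGroup) (c : E4) (M : ℝ) {t : ℝ} {ξ : E3} {R : ℝ}, 0 < R → (∀ y : E3, E4.spatial (poincareInv Λ c (E4.ofTimeSpace t y)) = 0 → y ∈ ball ξ R) → LandauLifshitz.quasiLocalMomentum (boostedKerrBilin Λ c M 0) t ξ R 0 = M * (√(1 - ‖(((Λ : E4 ≃L[ℝ] E4) (E4.basisVector 0)) 0)⁻¹ • E4.spatial ((Λ : E4 ≃L[ℝ] E4) (E4.basisVector 0))‖ ^ 2))⁻¹ :=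
  fun Λ c M _t _ξ _R hR hencl ↦
    SublinearIsFree.ChargeModel.quasiLocalMomentum_boostedSchwarzschild_energy Λ c M hR hencl

/-- Registered sub-goal form (stub `ll_boostedSchwarzschild_momentum` of the crux item) of
`SublinearIsFree.ChargeModel.quasiLocalMomentum_boostedSchwarzschild_momentum`: the LL momentum of a
boosted Schwarzschild hole on every enclosing lab sphere is `Mγv`. [cite: LandauLifshitz1975, §96 (96.16)–(96.17)] -/
theorem ll_boostedSchwarzschild_momentum : open Literature.Geometry.Lorentzian Metric in ∀ (Λ : lorentzGroup) (c : E4) (M : ℝ) {t : ℝ} {ξ : E3} {R : ℝ}, 0 < R → (∀ y : E3, E4.spatial (poincareInv Λ c (E4.ofTimeSpace t y)) = 0 → y ∈ ball ξ R) → ∀ k : Fin 3, LandauLifshitz.quasiLocalMomentum (boostedKerrBilin Λ c M 0) t ξ R k.succ = M * (√(1 - ‖(((Λ : E4 ≃L[ℝ] E4) (E4.basisVector 0)) 0)⁻¹ • E4.spatial ((Λ : E4 ≃L[ℝ] E4) (E4.basisVector 0))‖ ^ 2))⁻¹ * ((((Λ : E4 ≃L[ℝ] E4) (E4.basisVector 0))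 0)⁻¹ • E4.spatial ((Λ : E4 ≃L[ℝ] E4) (E4.basisVector 0))) k :=
  fun Λ c M _t _ξ _R hR hencl k ↦
    SublinearIsFree.ChargeModel.quasiLocalMomentum_boostedSchwarzschild_momentum Λ c M hR hencl k

end Summit.FinalStateConjecture.FinalStateConjecture.Theorems

end
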